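import Mathlib.MeasureTheory.Integral.IntervalIntegral.Basic
import Mathlib.Probability.Process.Stopping
import Literature.Probability.RandomPlanarGeometry.SLEKappaRho
import Literature.Probability.RandomPlanarGeometry.LoewnerFlow
import HarnessLib

/-!
# Miller–Sheffield, Imaginary geometry I: the harmonic functions `𝔥_t(z)` of an SLE_κ(ρ) and their local martingale property

J. Miller, S. Sheffield, *Imaginary geometry I: interacting SLEs*, Probab. Theory Related Fields
**164** (2016) 553–705, arXiv:1201.1496 [MillerSheffield2016], read in the arXiv text: §1
Theorem 1.1 (the GFF/SLE_κ(ρ) coupling; Fig. 1.9–1.10: `λ = π/√κ`, `λ' = λ − πχ/2 = π√κ/4`,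
`χ = 2/√κ − √κ/2`), Theorem 1.2, and §2.3 **Theorem 2.4** (martingale characterisation):

> "Suppose we are given a random continuous curve `η` on `ℍ̄` from `0` to `∞` whose Loewner driving
> function `W_t` is almost surely continuous. Suppose that `x^{j,q}` and `ρ^{j,q}` values are given
> and that the `V_t^{j,q}` are defined to be the images of the `x^{j,q}` under the corresponding
> Loewner evolution. Let `𝔥_t` be the corresponding harmonic function in the statement of
> Theorem 1.1. Then `W_t` and the `V_t^{j,q}` can be coupled with a standard Brownian motion to
> describe an SLE_κ(ρ) process (up to the continuation threshold) if and only if `𝔥_t(z)` evolves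
> as a continuous local martingale in `t` for each fixed `z ∈ ℍ` until the time `z` is absorbed by
> `K_t`."

with, from Theorem 1.1, `𝔥_t(z) = 𝔥⁰_t(f_t(z)) − χ arg f_t'(z)`, `f_t = g_t − W_t`, where `𝔥⁰_t` is
the bounded harmonic function on `ℍ` with boundary values `−λ(1 + Σ_{i≤j} ρ^{i,L})` on
`[f_t(x^{j+1,L}), f_t(x^{j,L}))` and `λ(1 + Σ_{i≤j} ρ^{i,R})` on `[f_t(x^{j,R}), f_t(x^{j+1,R}))`
(`ρ^{0,L} = ρ^{0,R} = 0`, `x^{0,L} = 0⁻`, `x^{0,R} = 0⁺`, `x^{k+1,L} = −∞`, `x^{ℓ+1,R} = +∞`).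

## What is vendored, and in which vocabulary

The tree's SLE(κ, ρ) (`IsSLEKappaRhoPair κ ρ O W`, `SLEKappaRho.lean`, after [LSW] §8.3) is the
process with ONE force point, on the LEFT, started at `0⁻`, of weight `ρ > −2` (so that the
continuation threshold is infinite): `W` is the driving process and `O_t = V_t^{1,L} ≤ W_t` the
force point, both on the canonical space `(ℝ≥0 → ℝ, preWienerMeasure)` of the Brownian motion
`brownian`, with its natural filtration `brownianFiltration`.  For this vector of weights the
boundary data of `𝔥⁰_t` is `−λ(1+ρ)` on `(−∞, O_t − W_t)`, `−λ` on `[O_t − W_t, 0)` and `λ` on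
`[0, ∞)`, and writing the bounded harmonic function with piecewise constant data through harmonic
measures of intervals (`ω_w((a,b)) = (arg(w − b) − arg(w − a))/π`, `arg ∈ (0, π)` on `ℍ`) gives the
closed form

  `𝔥_t(z) = λ − (2λ/π) arg(g_t(z) − W_t) − (λρ/π) arg(g_t(z) − O_t) − χ arg g_t'(z)`,

`arg g_t'(z)` being the continuous branch `Im ∫₀ᵗ ∂_s log g_s'(z) ds = Im ∫₀ᵗ −2 ds/(g_s(z) − W_s)²`
(`∂_t log g_t' = −2/f_t²`, as in the printed proof of Theorem 2.4).  This file provides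

* `igLambda κ = π/√κ`, `igChi κ = 2/√κ − √κ/2`, `igLambdaPrime κ = λ − πχ/2` with the PROVED
  identities `igLambdaPrime_eq` (`= π√κ/4`) and `two_pi_mul_igChi` (`2πχ = (4 − κ)λ`, the identity
  behind the drift computation singling out SLE_κ);
* `Loewner.argDeriv U t z` (`arg g_t'(z)` as the integral above), `imaginaryHarmonic κ ρ U V z t`
  (the displayed `𝔥_t(z)` for a driving function `U` and a force-point function `V`), with the
  PROVED time-zero boundary values `imaginaryHarmonic_zero_ofReal_pos` (`= λ` on `(0,∞)`) and
  `imaginaryHarmonic_zero_ofReal_neg` (`= −λ(1+ρ)` on `(−∞,0)`) — i.e. the data of Fig. 1.10;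
* `Loewner.approachTime U z δ` — the first time `|g_t(z) − W_t| ≤ δ` (in `WithTop ℝ≥0`, `⊤` if
  never): these times increase to the absorption time of `z` as `δ ↓ 0` and are the localisation
  through which "local martingale until `z` is absorbed" is expressed without ever evaluating
  `g_t(z)` after absorption;
* the NAMED FACT `MillerSheffield2016_thm24_forward` — the (⇒) direction of Theorem 2.4 for this
  vector of weights: for `κ > 0`, `ρ > −2`, every SLE(κ, ρ) pair `(O, W)`, every `z ∈ ℍ` and
  `δ > 0`, the process `t ↦ 𝔥_t(z)` stopped at `approachTime δ` is a continuous local martingale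
  for `brownianFiltration` under `preWienerMeasure`.

## What is NOT vendored (and why)

* Theorem 1.1 itself (the coupling with a zero-boundary GFF `h`: "the conditional law of
  `(h + 𝔥_0)|_{ℍ∖K_τ}` given `K_τ` is the law of `𝔥_τ + h ∘ f_τ`") and Theorem 1.2 (`η` is a.s.
  determined by `h`): the tree has no Gaussian free field.
* The (⇐) direction of Theorem 2.4 (the martingale CHARACTERISATION: local martingales `𝔥_t(z)`
  for all `z` force the driving pair to be SLE_κ(ρ)) and every statement with right force points
  or several force points, in particular SLE_κ(ρ^L; ρ^R) with force points `0⁻, 0⁺` wanted by route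
  CriticalPhenomena/SAWTiltedExplorer: they need Miller–Sheffield's Definition 2.1 / Theorem 2.2
  (existence and uniqueness in law of multi-force-point SLE_κ(ρ) up to the continuation
  threshold), which is not in the tree; a definition request for `SLE_κ(ρ^L; ρ^R)` is the
  prerequisite.  The objects here (`imaginaryHarmonic`, `argDeriv`, `approachTime`) are written
  for an arbitrary driving function and force-point function so that they can be reused verbatim
  there.

## References

* [MillerSheffield2016] arXiv:1201.1496: Thm. 1.1 and Fig. 1.9–1.10 (§1), Thm. 1.2 (§1.4),
  Def. 2.1, Thm. 2.2, §2.3 Thm. 2.4 with its proof (`∂_t log f_t' = −2/f_t²`).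
* O. Schramm, S. Sheffield, *Contour lines of the two-dimensional discrete Gaussian free field*,
  Acta Math. 202 (2009) (the case `ρ ≡ 0`); J. Dubédat, *SLE and the free field: partition
  functions and couplings*, J. AMS 22 (2009) (Theorem 1.1 for general `ρ`), as cited there.
* [LawlerSchrammWerner2003Restriction] §8.3 (the tree's one-force-point SLE(κ, ρ)).
-/

noncomputable section

open MeasureTheory Complex Set
open scoped NNReal Real
open Literature.Probability.Process (preWienerMeasure)

namespace Literature.Probability.RandomPlanarGeometry

/-! ### The constants `λ`, `χ`, `λ'` -/

/-- `λ = π/√κ` (Miller–Sheffield 2016, Fig. 1.9). [cite: MillerSheffield2016, Fig. 1.9 (§1)] -/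
def igLambda (κ : ℝ≥0) : ℝ := π / Real.sqrt κ

/-- `χ = 2/√κ − √κ/2` (Miller–Sheffield 2016, Thm. 1.1). [cite: MillerSheffield2016, Thm. 1.1] -/
def igChi (κ : ℝ≥0) : ℝ := 2 / Real.sqrt κ - Real.sqrt κ / 2

/-- `λ' = λ − πχ/2` (Miller–Sheffield 2016, Fig. 1.9: the flow-line boundary values are `∓λ'` plus
`χ·winding`). [cite: MillerSheffield2016, Fig. 1.9 (§1)] -/
def igLambdaPrime (κ : ℝ≥0) : ℝ := igLambda κ - π * igChi κ / 2

/-- `λ' = π√κ/4` (Miller–Sheffield 2016, Fig. 1.9: "`λ' = λ − (π/2)χ = π√κ/4`").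
[cite: MillerSheffield2016, Fig. 1.9 (§1)] -/
theorem igLambdaPrime_eq {κ : ℝ≥0} (hκ : 0 < κ) : igLambdaPrime κ = π * Real.sqrt κ / 4 := by
  have hs : 0 < Real.sqrt κ := Real.sqrt_pos.2 (by exact_mod_cast hκ)
  have hsq : Real.sqrt κ * Real.sqrt κ = κ := Real.mul_self_sqrt (by exact_mod_cast hκ.le)
  unfold igLambdaPrime igLambda igChi
  field_simp
  nlinarith [hsq]

/-- `2πχ = (4 − κ)λ`: the identity by which the drift of `𝔥_t(z)` vanishes exactly for the SLE_κ
driving function (`χ = 0 ⟺ κ = 4`). [cite: MillerSheffield2016, Thm. 1.1 (χ) with Fig. 1.9 (λ)] -/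
theorem two_pi_mul_igChi {κ : ℝ≥0} (hκ : 0 < κ) :
    2 * π * igChi κ = (4 - (κ : ℝ)) * igLambda κ := by
  have hs : 0 < Real.sqrt κ := Real.sqrt_pos.2 (by exact_mod_cast hκ)
  have hsq : Real.sqrt κ * Real.sqrt κ = κ := Real.mul_self_sqrt (by exact_mod_cast hκ.le)
  unfold igLambda igChi
  field_simp
  nlinarith [hsq]

/-! ### `arg g_t'(z)`, the harmonic function `𝔥_t(z)`, approach times -/

/-- The continuous argument of `g_t'(z)` along the Loewner flow of the driving function `U`:
`arg g_t'(z) = Im log g_t'(z) = Im ∫₀ᵗ −2 ds/(g_s(z) − U_s)²` (`∂_t log g_t'(z) = −2/(g_t(z) − U_t)²`,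
`g_0' = 1`; Miller–Sheffield 2016, proof of Thm. 2.4: "`(d/dt) log f_t'(z) = −2/f_t²(z)`").
Meaningful before the absorption time of `z` (interval integral; `Loewner.map` is junk after).
[cite: MillerSheffield2016, proof of Thm. 2.4 (d/dt log f_t')] -/
def Loewner.argDeriv (U : ℝ≥0 → ℝ) (t : ℝ≥0) (z : ℂ) : ℝ :=
  (∫ s in (0 : ℝ)..(t : ℝ),
      (-2 : ℂ) / (Loewner.map U s.toNNReal z - (U s.toNNReal : ℂ)) ^ 2).im

/-- At time `0` the argument of `g_0' = id'` is `0`. [folklore] -/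
@[simp] theorem Loewner.argDeriv_zero (U : ℝ≥0 → ℝ) (z : ℂ) : Loewner.argDeriv U 0 z = 0 := by
  simp [Loewner.argDeriv]

/-- **`𝔥_t(z)` for one left force point** (Miller–Sheffield 2016, Thm. 1.1 / Fig. 1.10 with the
weights `ρ^L = (ρ)` at `x^{1,L} = 0⁻` and no right force point), for a driving function `U` with
Loewner maps `g_t = Loewner.map U t` and a force-point function `V` (`V_t = g_t(0⁻)`):
`𝔥_t(z) = λ − (2λ/π) arg(g_t(z) − U_t) − (λρ/π) arg(g_t(z) − V_t) − χ arg g_t'(z)` — the bounded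
harmonic function of `g_t(z) − U_t` with boundary values `−λ(1+ρ)` on `(−∞, V_t − U_t)`, `−λ` on
`[V_t − U_t, 0)`, `λ` on `[0, ∞)`, minus `χ arg g_t'(z)` (module docstring for the reduction of the
printed `𝔥⁰_t(f_t(z)) − χ arg f_t'(z)` to this closed form). [cite: MillerSheffield2016, Thm. 1.1 and Fig. 1.10] -/
def imaginaryHarmonic (κ : ℝ≥0) (ρ : ℝ) (U V : ℝ≥0 → ℝ) (z : ℂ) (t : ℝ≥0) : ℝ :=
  igLambda κ - (2 * igLambda κ / π) * arg (Loewner.map U t z - (U t : ℂ))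
    - (igLambda κ * ρ / π) * arg (Loewner.map U t z - (V t : ℂ))
    - igChi κ * Loewner.argDeriv U t z

/-- At time `0` (continuous `U` with `U 0 = V 0 = 0`): `𝔥_0(z) = λ − ((2+ρ)λ/π) arg z` for
`z ≠ 0`. [cite: MillerSheffield2016, Fig. 1.10] -/
theorem imaginaryHarmonic_zero {κ : ℝ≥0} {ρ : ℝ} {U V : ℝ≥0 → ℝ} (hU : Continuous U)
    (hU0 : U 0 = 0) (hV0 : V 0 = 0) {z : ℂ} (hz : z ≠ 0) :
    imaginaryHarmonic κ ρ U V z 0 = igLambda κ - ((2 + ρ) * igLambda κ / π) * arg z := by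
  have hmap : Loewner.map U 0 z = z := Loewner.map_zero_apply hU (by rwa [hU0, ofReal_zero])
  simp only [imaginaryHarmonic, hmap, hU0, hV0, ofReal_zero, sub_zero, Loewner.argDeriv_zero,
    mul_zero]
  ring

/-- **Boundary data on `(0, ∞)`**: `𝔥_0(x) = λ` for real `x > 0` (the data `λ(1 + ρ^{0,R}) = λ`
of Fig. 1.10 to the right of `0`). [cite: MillerSheffield2016, Thm. 1.1 (boundary data) and Fig. 1.10] -/
theorem imaginaryHarmonic_zero_ofReal_pos {κ : ℝ≥0} {ρ : ℝ} {U V : ℝ≥0 → ℝ} (hU : Continuous U)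
    (hU0 : U 0 = 0) (hV0 : V 0 = 0) {x : ℝ} (hx : 0 < x) :
    imaginaryHarmonic κ ρ U V (x : ℂ) 0 = igLambda κ := by
  rw [imaginaryHarmonic_zero hU hU0 hV0 (by exact_mod_cast hx.ne'), arg_ofReal_of_nonneg hx.le]
  ring

/-- **Boundary data on `(−∞, 0)`**: `𝔥_0(x) = −λ(1+ρ)` for real `x < 0` (the data
`−λ(1 + ρ^{0,L} + ρ^{1,L})` of Fig. 1.10 to the left of the force point `x^{1,L} = 0⁻`).
[cite: MillerSheffield2016, Thm. 1.1 (boundary data) and Fig. 1.10] -/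
theorem imaginaryHarmonic_zero_ofReal_neg {κ : ℝ≥0} {ρ : ℝ} {U V : ℝ≥0 → ℝ} (hU : Continuous U)
    (hU0 : U 0 = 0) (hV0 : V 0 = 0) {x : ℝ} (hx : x < 0) :
    imaginaryHarmonic κ ρ U V (x : ℂ) 0 = -(igLambda κ * (1 + ρ)) := by
  rw [imaginaryHarmonic_zero hU hU0 hV0 (by exact_mod_cast hx.ne), arg_ofReal_of_neg hx]
  have hπ : (π : ℝ) ≠ 0 := Real.pi_ne_zero
  field_simp
  ring

/-- **Approach times.** `approachTime U z δ` is the first time `t` with `|g_t(z) − U_t| ≤ δ`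
(`⊤` if there is none), valued in `WithTop ℝ≥0` as Mathlib's stopped processes expect.  For a
continuous driving function a point `z ∈ ℍ` is absorbed at time `T_z < ∞` only if
`liminf_{t↑T_z} |g_t(z) − U_t| = 0`, so these times are `< T_z` and increase to `T_z` as `δ ↓ 0`:
stopping at them expresses "until the time `z` is absorbed by `K_t`" (Miller–Sheffield 2016,
Thm. 2.4) without evaluating `g_t(z)` after absorption. [cite: MillerSheffield2016, Thm. 2.4 ("until the time z is absorbed")] -/
def Loewner.approachTime (U : ℝ≥0 → ℝ) (z : ℂ) (δ : ℝ) : WithTop ℝ≥0 :=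
  sInf ((fun t : ℝ≥0 ↦ (t : WithTop ℝ≥0)) '' {t : ℝ≥0 | ‖Loewner.map U t z - (U t : ℂ)‖ ≤ δ})

/-- If the distance is already `≤ δ` at time `t`, the approach time is at most `t`. [folklore] -/
theorem Loewner.approachTime_le {U : ℝ≥0 → ℝ} {z : ℂ} {δ : ℝ} {t : ℝ≥0}
    (ht : ‖Loewner.map U t z - (U t : ℂ)‖ ≤ δ) : Loewner.approachTime U z δ ≤ t :=
  sInf_le ⟨t, ht, rfl⟩

/-- If the distance never gets `≤ δ`, the approach time is `⊤`. [folklore] -/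
theorem Loewner.approachTime_eq_top {U : ℝ≥0 → ℝ} {z : ℂ} {δ : ℝ}
    (h : ∀ t : ℝ≥0, δ < ‖Loewner.map U t z - (U t : ℂ)‖) : Loewner.approachTime U z δ = ⊤ := by
  have hempty : ((fun t : ℝ≥0 ↦ (t : WithTop ℝ≥0)) ''
      {t : ℝ≥0 | ‖Loewner.map U t z - (U t : ℂ)‖ ≤ δ}) = ∅ := by
    ext T
    simp only [mem_image, mem_setOf_eq, mem_empty_iff_false, iff_false, not_exists, not_and]
    intro t ht
    exact absurd ht (not_le.2 (h t))
  rw [Loewner.approachTime, hempty, sInf_empty]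

/-! ### Theorem 2.4, forward direction, for the tree's SLE(κ, ρ) -/

/-- The process `(t, ω) ↦ 𝔥_t(z)(ω)` of an SLE(κ, ρ) driving pair `(O, W)` on the canonical space
(driving function `s ↦ W s ω`, force point `s ↦ O s ω`). [cite: MillerSheffield2016, Thm. 1.1 and Thm. 2.4] -/
def imaginaryHarmonicProcess (κ : ℝ≥0) (ρ : ℝ) (O W : ℝ≥0 → (ℝ≥0 → ℝ) → ℝ) (z : ℂ) :
    ℝ≥0 → (ℝ≥0 → ℝ) → ℝ :=
  fun t ω ↦ imaginaryHarmonic κ ρ (fun s ↦ W s ω) (fun s ↦ O s ω) z t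

/-- **Miller–Sheffield 2016, Theorem 2.4 (⇒), one left force point** (named fact): "That `𝔥_t`
evolves as a continuous local martingale if `W_t` and `V_t^{j,q}` correspond to an SLE_κ(ρ) can be
seen by applying Itô's formula (away from times when `W_t` collides with a force point) […]" — for
`κ > 0`, `ρ > −2` (continuation threshold `= ∞`), every SLE(κ, ρ) driving pair `(O, W)` of the tree
(`IsSLEKappaRhoPair`: force point `O_t = V_t^{1,L}`, started at `0⁻`), every `z ∈ ℍ` and `δ > 0`:
the process `t ↦ 𝔥_t(z)` stopped at the approach time `inf{t : |g_t(z) − W_t| ≤ δ}` is a local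
martingale with respect to the Brownian filtration under the pre-Wiener measure, with almost
surely continuous paths ("a continuous local martingale … until the time `z` is absorbed by `K_t`",
localised along `δ ↓ 0`). [cite: MillerSheffield2016, Thm. 2.4 (forward direction), with Thm. 1.1 / Fig. 1.10 for 𝔥_t] -/
def MillerSheffield2016_thm24_forward : Prop :=
  ∀ (κ : ℝ≥0) (ρ : ℝ), 0 < κ → -2 < ρ → ∀ O W : ℝ≥0 → (ℝ≥0 → ℝ) → ℝ, IsSLEKappaRhoPair κ ρ O W →
    ∀ z : ℂ, 0 < z.im → ∀ δ : ℝ, 0 < δ →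
      IsLocalMartingale
          (stoppedProcess (imaginaryHarmonicProcess κ ρ O W z)
            (fun ω ↦ Loewner.approachTime (fun s ↦ W s ω) z δ))
          brownianFiltration preWienerMeasure ∧
        ∀ᵐ ω ∂preWienerMeasure, Continuous fun t : ℝ≥0 ↦
          stoppedProcess (imaginaryHarmonicProcess κ ρ O W z)
            (fun ω ↦ Loewner.approachTime (fun s ↦ W s ω) z δ) t ω

end Literature.Probability.RandomPlanarGeometry

end
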